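import Mathlib
import HarnessLib
import Summits.HubbardSuperconductivity.HubbardSuperconductivity.Theorems.KLProgrammeKLRegimeEngineTowerChernoff
import Summits.HubbardSuperconductivity.HubbardSuperconductivity.Theorems.KLProgrammeKLRegimeEngineTowerSplitCount

/-!
# Route `KLProgramme` — crux K3 ENGINE (stmt-HubbardSuperconductivity-20437 `KLRegimeEngineV17F2`), stub (b): the blocked-tower bookkeeping,
# part 9 — the induction with the SPLIT (correlated) count: two coupled tracks (E1 lead r2d-p2 g5; U7-(c1), memo E1-TOWER-BLOCKED §10)

The levels reduction of §10: in per-track units every track obeys the same law, the step for any output track is bounded by the track-0 Chernoff data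
(the supplier absorbs the `≤ 3ⁿ` multiplicity of input-track assignments into `Φ`), so the only COUPLING between tracks is the re-measurement's
on-class row, which reads the ALL-KNOWN track's born sizes `b₂`.  Hence the core loop needs exactly two tracks — `b` (one leg pinned) and `b₂`
(all labels known) — and closes by simultaneous induction:

* `towerMeasured_three_le_split` — six legs, two rows: `μ k 3 ≤ Σ c₁c₂³g₃^{k+1−k′} b k′ 3 + Σ c₃c₂³ h^{k′} b₂ k′ 3` ⇒ `μ k 3 ≤ ι₃λ²`,
  `ι₃ = (c₁g₃/(1−g₃) + c₃/(1−h))·c₂³AQ³` (n-free; with the marginal-only-on-class count of the lattice window, `g₃ = g` off-class and `h = 4^{−d}`);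
* **`towerBorn_le_law_split`** (T3₅) — as `towerBorn_le_law₄` with (Hμ) two-row in degrees `2m ≥ 8` (`towerMeasured_le_profile_split`, part 8) and at
  six legs (above), the UV profile and a step hypothesis for BOTH tracks (same Chernoff data `μ k ·`), `A′ ≥ (c₁/((1−g)g²) + c₃/((1−h)g³))·A`:
  ⊢ `∀ k ≤ K, ∀ 3 ≤ p ≤ D, b k p ≤ Aλ^{p−1}Q^p ∧ b₂ k p ≤ Aλ^{p−1}Q^p`.
The intermediate tracks (gain 1) are then read off afterwards (their steps read the same data); the GAIN itself (`2^{−e′J}` per track) lives in the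
suppliers' absolute statements (G1-L + p4's split counts), not here.  Pure real analysis; nothing about the model is asserted.
-/

noncomputable section

namespace Summit.HubbardSuperconductivity.HubbardSuperconductivity.Theorems.EngineV8

set_option linter.dupNamespace false -- summit = problem name (single-conjunct summit), D-0017

open Real Finset

/-- **Six-leg re-measurement, two rows**: off-class at ratio `g₃` on `b`, on-class with the absolute-level weight `h^{k′}` (no `g`) on the all-known
track `b₂`; both `≤ Aλ²Q³` for `k′ ≤ k` ⇒ `μ k 3 ≤ (c₁·g₃/(1−g₃) + c₃/(1−h))·c₂³·A·Q³·λ²`. -/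
theorem towerMeasured_three_le_split {b b₂ μ : ℕ → ℕ → ℝ} {A Q g₃ h c₁ c₂ c₃ lam : ℝ}
    (hA : 0 ≤ A) (hQ : 0 ≤ Q) (hg0 : 0 ≤ g₃) (hg1 : g₃ < 1) (hh0 : 0 ≤ h) (hh1 : h < 1) (hc₁ : 0 ≤ c₁) (hc₂ : 0 ≤ c₂) (hc₃ : 0 ≤ c₃)
    (hb0 : ∀ k m, 0 ≤ b k m) (hb₂0 : ∀ k m, 0 ≤ b₂ k m) {k : ℕ}
    (hμ : μ k 3 ≤ ∑ k' ∈ range (k + 1), c₁ * c₂ ^ 3 * g₃ ^ (k + 1 - k') * b k' 3 + ∑ k' ∈ range (k + 1), c₃ * c₂ ^ 3 * h ^ k' * b₂ k' 3)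
    (hborn : ∀ k' ≤ k, b k' 3 ≤ A * lam ^ 2 * Q ^ 3) (hborn₂ : ∀ k' ≤ k, b₂ k' 3 ≤ A * lam ^ 2 * Q ^ 3) :
    μ k 3 ≤ (c₁ * (g₃ / (1 - g₃)) + c₃ * (1 / (1 - h))) * c₂ ^ 3 * A * Q ^ 3 * lam ^ 2 := by
  have hh1' : 0 < 1 - h := sub_pos.2 hh1
  set μoff : ℕ → ℕ → ℝ := fun k _ => ∑ k' ∈ range (k + 1), c₁ * c₂ ^ 3 * g₃ ^ (k + 1 - k') * b k' 3 with hμoff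
  have hoff : μoff k 3 ≤ c₁ * c₂ ^ 3 * A * Q ^ 3 * (g₃ / (1 - g₃)) * lam ^ 2 :=
    towerMeasured_three_le (μ := μoff) hA hQ hg0 hg1 hc₁ hc₂ hb0 le_rfl hborn
  have hon : ∑ k' ∈ range (k + 1), c₃ * c₂ ^ 3 * h ^ k' * b₂ k' 3 ≤ c₃ * c₂ ^ 3 * A * Q ^ 3 * (1 / (1 - h)) * lam ^ 2 := by
    have hterm : ∀ k' ∈ range (k + 1), c₃ * c₂ ^ 3 * h ^ k' * b₂ k' 3 ≤ (c₃ * c₂ ^ 3 * (A * lam ^ 2 * Q ^ 3)) * h ^ k' := by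
      intro k' hk'
      have := hborn₂ k' (Nat.lt_succ_iff.1 (mem_range.1 hk'))
      have := hb₂0 k' 3
      calc c₃ * c₂ ^ 3 * h ^ k' * b₂ k' 3 ≤ c₃ * c₂ ^ 3 * h ^ k' * (A * lam ^ 2 * Q ^ 3) := by gcongr
        _ = _ := by ring
    refine (sum_le_sum hterm).trans ?_
    rw [← mul_sum]
    have hgeom : ∑ k' ∈ range (k + 1), h ^ k' ≤ 1 / (1 - h) := by
      have := geom_sum_Ico_le_of_lt_one hh0 hh1 (m := 0) (n := k + 1)
      rwa [pow_zero, ← range_eq_Ico] at this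
    calc c₃ * c₂ ^ 3 * (A * lam ^ 2 * Q ^ 3) * ∑ k' ∈ range (k + 1), h ^ k' ≤ c₃ * c₂ ^ 3 * (A * lam ^ 2 * Q ^ 3) * (1 / (1 - h)) :=
          mul_le_mul_of_nonneg_left hgeom (by positivity)
      _ = _ := by ring
  calc μ k 3 ≤ μoff k 3 + ∑ k' ∈ range (k + 1), c₃ * c₂ ^ 3 * h ^ k' * b₂ k' 3 := hμ
    _ ≤ _ := add_le_add hoff hon
    _ = _ := by ring

/-- **(T3₅) The blocked birth-level tower with the split (correlated) count — two coupled tracks.**  Born sizes `b` (one leg pinned) and `b₂`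
(all labels known, in its own units); the re-measurement of the track-0 inputs has the off-class row on `b` and the on-class row on `b₂` (degrees
`2m ≥ 8`: ratios `g^{(m−2)·jump}` / `g^{(m−3)·jump}·h^{k′}`; six legs: `g₃^{jump}` / `h^{k′}`); the step hypothesis is asked for BOTH tracks with the SAME
Chernoff data `μ k ·` (the supplier's `3ⁿ` inside `Φ`); numerics as T3₄ with `A′ ≥ (c₁/((1−g)g²) + c₃/((1−h)g³))·A`,
`ι₃ ≥ (c₁g₃/(1−g₃) + c₃/(1−h))·c₂³AQ³`.  Conclusion: both tracks obey `Aλ^{p−1}Q^p` at every boundary. -/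
theorem towerBorn_le_law_split {D K : ℕ} {b b₂ μ : ℕ → ℕ → ℝ} {A lam Q g g₃ h c₁ c₂ c₃ σ Φ ψ τ A' Q' ι₁ ι₂ ι₃ : ℝ}
    (hA : 0 ≤ A) (hlam : 0 < lam) (hQ : 0 ≤ Q) (hg0 : 0 < g) (hg1 : g < 1) (hg₃0 : 0 ≤ g₃) (hg₃1 : g₃ < 1) (hh0 : 0 ≤ h) (hh1 : h < 1) (hc₁ : 0 ≤ c₁) (hc₂ : 0 ≤ c₂) (hc₃ : 0 ≤ c₃)
    (hσ : 0 ≤ σ) (hΦ : 0 ≤ Φ) (hψ : 0 ≤ ψ) (hτ : 0 < τ) (hQ'0 : 0 < Q') (hA'ge : (c₁ / ((1 - g) * g ^ 2) + c₃ / ((1 - h) * g ^ 3)) * A ≤ A') (hQ'ge : c₂ * g * Q ≤ Q')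
    (hι₃ge : (c₁ * (g₃ / (1 - g₃)) + c₃ * (1 / (1 - h))) * c₂ ^ 3 * A * Q ^ 3 ≤ ι₃)
    (hb0 : ∀ k m, 0 ≤ b k m) (hb₂0 : ∀ k m, 0 ≤ b₂ k m) (hμ0 : ∀ k m, 0 ≤ μ k m)
    (h0 : ∀ p, 3 ≤ p → p ≤ D → b 0 p ≤ A * lam ^ (p - 1) * Q ^ p) (h0₂ : ∀ p, 3 ≤ p → p ≤ D → b₂ 0 p ≤ A * lam ^ (p - 1) * Q ^ p)
    (hμ : ∀ k < K, ∀ m, 4 ≤ m → m ≤ D →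
      μ k m ≤ ∑ k' ∈ range (k + 1), c₁ * c₂ ^ m * g ^ ((m - 2) * (k + 1 - k')) * b k' m +
        ∑ k' ∈ range (k + 1), c₃ * c₂ ^ m * g ^ ((m - 3) * (k + 1 - k')) * h ^ k' * b₂ k' m)
    (hμ3 : ∀ k < K, 3 ≤ D → μ k 3 ≤ ∑ k' ∈ range (k + 1), c₁ * c₂ ^ 3 * g₃ ^ (k + 1 - k') * b k' 3 +
      ∑ k' ∈ range (k + 1), c₃ * c₂ ^ 3 * h ^ k' * b₂ k' 3)
    (hι₁ : ∀ k < K, μ k 1 ≤ ι₁ * lam) (hι₂ : ∀ k < K, μ k 2 ≤ ι₂ * lam)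
    (hstep : ∀ k < K, ∀ N : ℕ, 2 ≤ N → ∀ p, 3 ≤ p → p ≤ D → Φ * towerV D τ (μ k) < 1 →
      b (k + 1) p ≤ towerFO D σ (μ k) p + ∑ n ∈ Icc 2 N, exp 1 * Φ ^ (n - 1) * ψ ^ p * towerS D τ (μ k) n p +
        ψ ^ p * exp 1 * towerV D τ (μ k) * (Φ * towerV D τ (μ k)) ^ N / (1 - Φ * towerV D τ (μ k)))
    (hstep₂ : ∀ k < K, ∀ N : ℕ, 2 ≤ N → ∀ p, 3 ≤ p → p ≤ D → Φ * towerV D τ (μ k) < 1 →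
      b₂ (k + 1) p ≤ towerFO D σ (μ k) p + ∑ n ∈ Icc 2 N, exp 1 * Φ ^ (n - 1) * ψ ^ p * towerS D τ (μ k) n p +
        ψ ^ p * exp 1 * towerV D τ (μ k) * (Φ * towerV D τ (μ k)) ^ N / (1 - Φ * towerV D τ (μ k)))
    (hx₁ : 4 * σ * lam * Q' < 1) (hx₂ : 2 * lam * τ * Q' ≤ 1) (hx₃ : exp 1 * τ * lam * Q' < 1)
    (hy : Φ * (τ * (ι₁ * lam + ι₂ / (2 * Q') + ι₃ / (4 * Q' ^ 2) + A' * Q' / 4)) < 1)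
    (hθ : Φ * (exp 1 * τ * (ι₁ * lam) + (exp 1 * τ) ^ 2 * (ι₂ * lam) + (exp 1 * τ) ^ 3 * (ι₃ * lam ^ 2) +
      A' * (exp 1 * τ * Q') * ((exp 1 * τ * lam * Q') ^ 3 / (1 - exp 1 * τ * lam * Q'))) < 1)
    (hu₁ : 4 * Q' ≤ Q) (hu₂ : 2 * τ * ψ * Q' ≤ Q)
    (hclose : A' * (4 * Q') ^ 3 * (4 * σ * lam * Q' / (1 - 4 * σ * lam * Q')) +
      exp 1 * ψ * (2 * τ * ψ * Q') ^ 2 * (τ * (ι₁ * lam + ι₂ / (2 * Q') + ι₃ / (4 * Q' ^ 2) + A' * Q' / 4)) *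
        (Φ * (τ * (ι₁ * lam + ι₂ / (2 * Q') + ι₃ / (4 * Q' ^ 2) + A' * Q' / 4)) /
          (1 - Φ * (τ * (ι₁ * lam + ι₂ / (2 * Q') + ι₃ / (4 * Q' ^ 2) + A' * Q' / 4)))) ≤ A * Q ^ 3) :
    ∀ k ≤ K, ∀ p, 3 ≤ p → p ≤ D → b k p ≤ A * lam ^ (p - 1) * Q ^ p ∧ b₂ k p ≤ A * lam ^ (p - 1) * Q ^ p := by
  have hg1' : 0 < 1 - g := sub_pos.2 hg1
  have hg₃1' : 0 < 1 - g₃ := sub_pos.2 hg₃1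
  have hh1' : 0 < 1 - h := sub_pos.2 hh1
  have hA'0 : 0 ≤ A' := le_trans (by positivity) hA'ge
  have hx10 : 0 ≤ 4 * σ * lam * Q' / (1 - 4 * σ * lam * Q') := div_nonneg (by positivity) (sub_nonneg.2 hx₁.le)
  have hw : 1 ≤ (2 * τ * Q' * lam)⁻¹ := (one_le_inv₀ (by positivity)).2 (by linarith)
  set Y := ι₁ * lam + ι₂ / (2 * Q') + ι₃ / (4 * Q' ^ 2) + A' * Q' / 4 with hY
  suffices H : ∀ k ≤ K, ∀ k' ≤ k, ∀ p, 3 ≤ p → p ≤ D →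
      b k' p ≤ A * lam ^ (p - 1) * Q ^ p ∧ b₂ k' p ≤ A * lam ^ (p - 1) * Q ^ p from
    fun k hk p hp hpD => H k hk k le_rfl p hp hpD
  intro k
  induction k with
  | zero => intro _ k' hk' p hp hpD; rw [Nat.le_zero.1 hk']; exact ⟨h0 p hp hpD, h0₂ p hp hpD⟩
  | succ k ih =>
    intro hk1 k' hk' p hp hpD
    have hkK : k < K := Nat.lt_of_succ_le hk1
    have ih' := ih (Nat.le_of_succ_le hk1)
    have ih₀ : ∀ k' ≤ k, ∀ p, 3 ≤ p → p ≤ D → b k' p ≤ A * lam ^ (p - 1) * Q ^ p := fun k' hk' p hp hpD => (ih' k' hk' p hp hpD).1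
    have ih₂ : ∀ k' ≤ k, ∀ p, 3 ≤ p → p ≤ D → b₂ k' p ≤ A * lam ^ (p - 1) * Q ^ p := fun k' hk' p hp hpD => (ih' k' hk' p hp hpD).2
    rcases Nat.lt_succ_iff_lt_or_eq.1 (Nat.lt_succ_of_le hk') with hlt | rfl
    · exact ih' k' (Nat.lt_succ_iff.1 hlt) p hp hpD
    · have hD3 : 3 ≤ D := hp.trans hpD
      -- degrees ≥ 8: the measured profile from the split re-measurement lemma applied to `μ` with the six-leg entry zeroed
      set μ4 : ℕ → ℕ → ℝ := fun k m => if 4 ≤ m then μ k m else 0 with hμ4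
      have hμ4hyp : ∀ m, 3 ≤ m → m ≤ D → μ4 k m ≤
          ∑ k' ∈ range (k + 1), c₁ * c₂ ^ m * g ^ ((m - 2) * (k + 1 - k')) * b k' m +
            ∑ k' ∈ range (k + 1), c₃ * c₂ ^ m * g ^ ((m - 3) * (k + 1 - k')) * h ^ k' * b₂ k' m := by
        intro m hm3 hmD
        rw [hμ4]; dsimp only
        split_ifs with h4
        · exact hμ k hkK m h4 hmD
        · exact add_nonneg (sum_nonneg fun k' _ => by have := hb0 k' m; positivity)
            (sum_nonneg fun k' _ => by have := hb₂0 k' m; positivity)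
      have hprof : ∀ m, 4 ≤ m → m ≤ D → μ k m ≤ A' * lam ^ (m - 1) * Q' ^ m := by
        intro m hm4 hmD
        have hT1 := towerMeasured_le_profile_split (D := D) (μ := μ4) hA hlam.le hQ hg0 hg1 hh0 hh1 hc₁ hc₂ hc₃ hb0 hb₂0 hμ4hyp ih₀ ih₂
          (by omega) hmD
        rw [hμ4] at hT1; dsimp only at hT1; rw [if_pos hm4] at hT1
        refine hT1.trans ?_
        have : 0 ≤ (c₁ / ((1 - g) * g ^ 2) + c₃ / ((1 - h) * g ^ 3)) * A := by positivity
        have : 0 ≤ c₂ * g * Q := by positivity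
        gcongr
      -- six legs: the import `ι₃ λ²` from the two-row six-leg re-measurement
      have hμ3' : μ k 3 ≤ ι₃ * lam ^ 2 := by
        have h := towerMeasured_three_le_split hA hQ hg₃0 hg₃1 hh0 hh1 hc₁ hc₂ hc₃ hb0 hb₂0 (hμ3 k hkK hD3)
          (fun k' hk' => ih₀ k' hk' 3 le_rfl hD3) (fun k' hk' => ih₂ k' hk' 3 le_rfl hD3)
        exact h.trans (mul_le_mul_of_nonneg_right hι₃ge (sq_nonneg lam))
      -- Chernoff data
      have hG := sum_fourPiece_le (D := D) hτ hlam hQ'0 hA'0 (hμ0 k) (hι₁ k hkK) (hι₂ k hkK) hμ3' hprof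
      have hG0 : 0 ≤ τ * Y := (sum_nonneg fun δ _ => by have := hμ0 k δ; positivity).trans hG
      have hY0' : 0 ≤ Y := (mul_nonneg_iff_of_pos_left hτ).1 hG0
      have hVb := towerV_le_fourPiece hτ.le hlam.le hQ'0.le hA'0 (hμ0 k) (hι₁ k hkK) (hι₂ k hkK) hμ3' hprof hx₃
      have hFO := towerFO_le_of_four_le hσ hA'0 hlam.le hQ'0.le (hμ0 k) hprof hx₁ hp (D := D)
      -- the closing computation, for any born size obeying the step hypothesis with these Chernoff data
      have hclose' : ∀ x : ℝ, (∀ N : ℕ, 2 ≤ N → Φ * towerV D τ (μ k) < 1 →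
          x ≤ towerFO D σ (μ k) (3 + (p - 3)) + ∑ n ∈ Icc 2 N, exp 1 * Φ ^ (n - 1) * ψ ^ (3 + (p - 3)) * towerS D τ (μ k) n (3 + (p - 3)) +
            ψ ^ (3 + (p - 3)) * exp 1 * towerV D τ (μ k) * (Φ * towerV D τ (μ k)) ^ N / (1 - Φ * towerV D τ (μ k))) →
          x ≤ A * lam ^ (3 + (p - 3) - 1) * Q ^ (3 + (p - 3)) := by
        intro x hx
        have hT2 := towerStep_le_of_chernoff (D := D) hΦ hψ hτ.le (hμ0 k) hw
          (towerFO_le_of_four_le hσ hA'0 hlam.le hQ'0.le (hμ0 k) hprof hx₁ (p := 3 + (p - 3)) (by omega) (D := D)) hG hVb hy hθ hx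
        refine hT2.trans ?_
        have hinv : (((2 * τ * Q' * lam)⁻¹) ^ (3 + (p - 3) - 1))⁻¹ = (2 * τ * Q' * lam) ^ (3 + (p - 3) - 1) := by rw [inv_pow, inv_inv]
        rw [hinv]
        have hyq0 : 0 ≤ Φ * (τ * Y) / (1 - Φ * (τ * Y)) := div_nonneg (by positivity) (sub_nonneg.2 hy.le)
        set r := p - 3 with hr
        have h4 : (4 * Q') ^ (3 + r) ≤ (4 * Q') ^ 3 * Q ^ r := by
          rw [pow_add]; exact mul_le_mul_of_nonneg_left (pow_le_pow_left₀ (by positivity) hu₁ r) (by positivity)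
        have h2 : ψ ^ (3 + r) * (2 * τ * Q' * lam) ^ (3 + r - 1) ≤ lam ^ (3 + r - 1) * ψ * ((2 * τ * ψ * Q') ^ 2 * Q ^ r) := by
          have heq : ψ ^ (3 + r) * (2 * τ * Q' * lam) ^ (3 + r - 1) = lam ^ (3 + r - 1) * ψ * ((2 * τ * ψ * Q') ^ 2 * (2 * τ * ψ * Q') ^ r) := by
            rw [show 3 + r - 1 = r + 2 by omega, show 3 + r = r + 2 + 1 by omega]
            ring
          rw [heq]
          have hr' : (2 * τ * ψ * Q') ^ r ≤ Q ^ r := pow_le_pow_left₀ (by positivity) hu₂ r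
          exact mul_le_mul_of_nonneg_left (mul_le_mul_of_nonneg_left hr' (by positivity)) (by positivity)
        set X₁ := 4 * σ * lam * Q' / (1 - 4 * σ * lam * Q') with hX₁
        set Z := Φ * (τ * Y) / (1 - Φ * (τ * Y)) with hZ
        calc A' * lam ^ (3 + r - 1) * (4 * Q') ^ (3 + r) * X₁ + exp 1 * ψ ^ (3 + r) * (2 * τ * Q' * lam) ^ (3 + r - 1) * (τ * Y) * Z
            ≤ A' * lam ^ (3 + r - 1) * ((4 * Q') ^ 3 * Q ^ r) * X₁ +
                exp 1 * (lam ^ (3 + r - 1) * ψ * ((2 * τ * ψ * Q') ^ 2 * Q ^ r)) * (τ * Y) * Z := by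
              have : exp 1 * ψ ^ (3 + r) * (2 * τ * Q' * lam) ^ (3 + r - 1) = exp 1 * (ψ ^ (3 + r) * (2 * τ * Q' * lam) ^ (3 + r - 1)) := by
                ring
              rw [this]
              gcongr
          _ = lam ^ (3 + r - 1) * Q ^ r * (A' * (4 * Q') ^ 3 * X₁ + exp 1 * ψ * (2 * τ * ψ * Q') ^ 2 * (τ * Y) * Z) := by ring
          _ ≤ lam ^ (3 + r - 1) * Q ^ r * (A * Q ^ 3) := mul_le_mul_of_nonneg_left hclose (by positivity)
          _ = A * lam ^ (3 + r - 1) * Q ^ (3 + r) := by rw [pow_add]; ring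
      have hp3 : p = 3 + (p - 3) := by omega
      constructor
      · have h := hclose' (b (k + 1) p) (fun N hN hguard => by rw [← hp3]; exact hstep k hkK N hN p hp hpD hguard)
        rwa [← hp3] at h
      · have h := hclose' (b₂ (k + 1) p) (fun N hN hguard => by rw [← hp3]; exact hstep₂ k hkK N hN p hp hpD hguard)
        rwa [← hp3] at h

end Summit.HubbardSuperconductivity.HubbardSuperconductivity.Theorems.EngineV8

end
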